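import Summits.Ventures.CertifiedArithmetic.Expansions.Orient2dStageBBounds
import Mathlib.Tactic.Linarith
import Mathlib.Tactic.Positivity
import Mathlib.Tactic.Ring
import Mathlib.Tactic.NormNum

/-!
# INCIRCLE, stage B, part 1: the error analysis behind the stage-B test, constant left open

NEW WORK in the sense of this development: the algorithm, the shape of the test and the published
constant `iccerrboundB = (4 + 48ε)ε` are Shewchuk's (`predicates.c`, `incircleadapt`; Table 5
p. 352, line B); the error analysis is ours (the paper prints line B without a derivation) — the
INCIRCLE twin of `Orient3dStageBBounds.lean` (not imported: not yet built on the proof farm, whence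
one `private` copy).  Which constants it certifies: the companion `IncircleStageBMargins.lean`.

THE TEST.  After the stage-A filter (`Literature…IncircleStageA`) falls through, `incircleadapt`
computes the six differences `x = (a ⊖ d, …)`, the 96-component expansion `fin1` with
`Σ fin1 = B :=` the incircle determinant of the COMPUTED differences (exactly),
`det = estimate(fin1)`, `errbound = iccerrboundB ⊗ permanent` with the `permanent` of stage A
(`Σ_cyclic (|x_b ⊗ y_c| ⊕ |x_c ⊗ y_b|) ⊗ lift_a`, `lift_a = x_a ⊗ x_a ⊕ y_a ⊗ y_a`), and returns
`det` if `det ≥ errbound ∨ −det ≥ errbound`.  Soundness requires `det` to have the sign of the TRUE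
determinant `T` (the same polynomial in the true differences `t = x ± ε|x|`).

THE ANALYSIS (`incircle_stageB_sign_of_bounds`, rationals only, the constant `K` and ESTIMATE's
relative error `δ` left as parameters).  With `Π = Σ L_a·(|P| + |P'|)` the exact permanent of the
COMPUTED lifts `L` and products `P` (as in stage A):
`|T − B| ≤ ((1 + ε)⁴ − 1)·Σ (x_a² + y_a²)(|x_b y_c| + |x_c y_b|) ≤ ((1 + ε)⁷ − (1 + ε)³)·Π`,
`(1 + ε)⁷ − (1 + ε)³ = 4ε + 18ε² + 34ε³ + 35ε⁴ + 21ε⁵ + 7ε⁶ + ε⁷`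
(`liftedCofactorB_sub_le_of_rel` with the lift error `(1 + ε)² − 1` of `sumSq_sub_sumSq_le_of_rel`;
`sumSq_le_of_rel`: `x² + y² ≤ (1 + ε)²L`; `|x x'| ≤ (1 + ε)|P|`); `errbound ≥ (1 − ε)⁵·K·Π`
(`incirclePermanent_ge`); `|det − B| ≤ δ|B|` and the passed test give `(1 + δ)|B| ≥ errbound`.
Hence `|T − B| < |B|` — `B`, `det`, `T` share their sign — as soon as THE MARGIN
`(1 + δ)(4ε + 18ε² + 34ε³ + 35ε⁴ + 21ε⁵ + 7ε⁶ + ε⁷) < (1 − ε)⁵·K` holds; for `K = (4 + Cε)ε`,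
`δ = kε` it reads `ε²(C − 38 − 4k) + O(ε³) > 0`.

References: J. R. Shewchuk, Discrete Comput. Geom. 18 (1997) 305–363, §4.4 (Table 5 p. 352) and
`predicates.c` (`incircle`, `incircleadapt`, `estimate`) [Shewchuk1997].
-/

namespace Summit.Ventures.CertifiedArithmetic.Expansions

open Literature.ComputerArithmetic.JeannerodRump2018
open Literature.ComputerArithmetic.BoldoJeannerodMelquiondMuller2023 hiding twoSum twoSum_fst
  isFloat_twoSum
open Literature.ComputerArithmetic.Shewchuk1997

variable {p : ℕ} {emin : ℤ}

/-! ## Lemmas -/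

/-- Sign transfer from `|a − b| < |b|` (private copy of the lemma of `Orient3dStageBBounds`). -/
private theorem sign_iff_of_abs_sub_lt {a b : ℚ} (h : |a - b| < |b|) :
    (0 < b ↔ 0 < a) ∧ (b < 0 ↔ a < 0) := by
  have hl := (abs_sub_lt_iff.mp h).1
  have hr := (abs_sub_lt_iff.mp h).2
  rcases lt_trichotomy b 0 with hneg | hzero | hpos
  · rw [abs_of_neg hneg] at hl hr
    exact ⟨⟨fun h' => absurd hneg (not_lt.mpr h'.le), fun h' => by linarith⟩,
      ⟨fun _ => by linarith, fun _ => hneg⟩⟩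
  · exfalso
    rw [hzero, abs_zero] at h
    exact absurd h (not_lt.mpr (abs_nonneg _))
  · rw [abs_of_pos hpos] at hl hr
    exact ⟨⟨fun _ => by linarith, fun _ => hpos⟩,
      ⟨fun h' => absurd hpos (not_lt.mpr h'.le), fun h' => by linarith⟩⟩

/-- **The exact lift of the true differences against that of the computed ones**: if
`tᵢ = xᵢ ± ε|xᵢ|` then `|(t₁² + t₂²) − (x₁² + x₂²)| ≤ (2ε + ε²)(x₁² + x₂²)` (`(1 + ε)² − 1` of the
lift). -/
theorem sumSq_sub_sumSq_le_of_rel {u t₁ t₂ x₁ x₂ : ℚ} (hu : 0 ≤ u) (h₁ : |t₁ - x₁| ≤ u * |x₁|)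
    (h₂ : |t₂ - x₂| ≤ u * |x₂|) :
    |(t₁ * t₁ + t₂ * t₂) - (x₁ * x₁ + x₂ * x₂)| ≤ (2 * u + u ^ 2) * (x₁ * x₁ + x₂ * x₂) := by
  have e₁ := abs_mul_sub_mul_le_of_rel hu h₁ h₁
  have e₂ := abs_mul_sub_mul_le_of_rel hu h₂ h₂
  rw [abs_mul_self] at e₁ e₂
  have hdec : (t₁ * t₁ + t₂ * t₂) - (x₁ * x₁ + x₂ * x₂)
      = (t₁ * t₁ - x₁ * x₁) + (t₂ * t₂ - x₂ * x₂) := by ring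
  rw [hdec]
  calc |(t₁ * t₁ - x₁ * x₁) + (t₂ * t₂ - x₂ * x₂)|
        ≤ |t₁ * t₁ - x₁ * x₁| + |t₂ * t₂ - x₂ * x₂| := abs_add_le _ _
    _ ≤ (2 * u + u ^ 2) * (x₁ * x₁) + (2 * u + u ^ 2) * (x₂ * x₂) := add_le_add e₁ e₂
    _ = (2 * u + u ^ 2) * (x₁ * x₁ + x₂ * x₂) := by ring

/-- **The exact lift of the computed differences against the COMPUTED lift**: with computed squares
`x_i² = S_i ± ε S_i` (`S_i ≥ 0`) and computed lift `S₁ + S₂ = L ± εL` (`L ≥ 0`),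
`x₁² + x₂² ≤ (1 + ε)²·L`. -/
theorem sumSq_le_of_rel {u x₁ x₂ S₁ S₂ L : ℚ} (hu : 0 ≤ u) (hS₁ : |x₁ * x₁ - S₁| ≤ u * |S₁|)
    (hS₂ : |x₂ * x₂ - S₂| ≤ u * |S₂|) (hS₁0 : 0 ≤ S₁) (hS₂0 : 0 ≤ S₂)
    (hL : |(S₁ + S₂) - L| ≤ u * |L|) (hL0 : 0 ≤ L) : x₁ * x₁ + x₂ * x₂ ≤ (1 + u) ^ 2 * L := by
  rw [abs_of_nonneg hS₁0] at hS₁; rw [abs_of_nonneg hS₂0] at hS₂; rw [abs_of_nonneg hL0] at hL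
  have h1 := (abs_sub_le_iff.mp hS₁).1
  have h2 := (abs_sub_le_iff.mp hS₂).1
  have h3 := (abs_sub_le_iff.mp hL).1
  have h4 : (1 + u) * (S₁ + S₂) ≤ (1 + u) * ((1 + u) * L) :=
    mul_le_mul_of_nonneg_left (by linarith) (by linarith)
  nlinarith

/-- **One cofactor term `lift · minor`, true vs computed differences**, with an arbitrary relative
error `v` on the lift: if `y₀ = z₀ ± v|z₀|` and `yᵢ = zᵢ ± ε|zᵢ|` (`i = 1..4`) then
`|y₀(y₁y₂ − y₃y₄) − z₀(z₁z₂ − z₃z₄)| ≤ (v(1 + ε)² + 2ε + ε²)·|z₀|(|z₁z₂| + |z₃z₄|)`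
(`= ((1 + v)(1 + ε)² − 1)·…`; with `v = (1 + ε)² − 1` the constant is `(1 + ε)⁴ − 1`). -/
theorem liftedCofactorB_sub_le_of_rel {u v y₀ y₁ y₂ y₃ y₄ z₀ z₁ z₂ z₃ z₄ : ℚ} (hu : 0 ≤ u)
    (hv : 0 ≤ v) (h₀ : |y₀ - z₀| ≤ v * |z₀|) (h₁ : |y₁ - z₁| ≤ u * |z₁|)
    (h₂ : |y₂ - z₂| ≤ u * |z₂|) (h₃ : |y₃ - z₃| ≤ u * |z₃|) (h₄ : |y₄ - z₄| ≤ u * |z₄|) :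
    |y₀ * (y₁ * y₂ - y₃ * y₄) - z₀ * (z₁ * z₂ - z₃ * z₄)| ≤
      (v * (1 + u) ^ 2 + 2 * u + u ^ 2) * (|z₀| * (|z₁ * z₂| + |z₃ * z₄|)) := by
  have e₁ := abs_mul_sub_mul_le_of_rel hu h₁ h₂
  have e₂ := abs_mul_sub_mul_le_of_rel hu h₃ h₄
  set S := |z₁ * z₂| + |z₃ * z₄| with hS
  have hS0 : 0 ≤ S := by rw [hS]; positivity
  have hm : |(y₁ * y₂ - y₃ * y₄) - (z₁ * z₂ - z₃ * z₄)| ≤ (2 * u + u ^ 2) * S := by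
    have hdec : (y₁ * y₂ - y₃ * y₄) - (z₁ * z₂ - z₃ * z₄) =
        (y₁ * y₂ - z₁ * z₂) - (y₃ * y₄ - z₃ * z₄) := by ring
    rw [hdec]
    calc |(y₁ * y₂ - z₁ * z₂) - (y₃ * y₄ - z₃ * z₄)|
          ≤ |y₁ * y₂ - z₁ * z₂| + |y₃ * y₄ - z₃ * z₄| := abs_sub _ _
      _ ≤ (2 * u + u ^ 2) * |z₁ * z₂| + (2 * u + u ^ 2) * |z₃ * z₄| := add_le_add e₁ e₂
      _ = (2 * u + u ^ 2) * S := by rw [hS]; ring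
  have hmabs : |y₁ * y₂ - y₃ * y₄| ≤ (1 + u) ^ 2 * S := by
    have h1 := abs_sub_abs_le_abs_sub (y₁ * y₂ - y₃ * y₄) (z₁ * z₂ - z₃ * z₄)
    have h2 : |z₁ * z₂ - z₃ * z₄| ≤ S := abs_sub _ _
    nlinarith
  have hdec : y₀ * (y₁ * y₂ - y₃ * y₄) - z₀ * (z₁ * z₂ - z₃ * z₄) =
      (y₀ - z₀) * (y₁ * y₂ - y₃ * y₄) + z₀ * ((y₁ * y₂ - y₃ * y₄) - (z₁ * z₂ - z₃ * z₄)) := by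
    ring
  rw [hdec]
  calc |(y₀ - z₀) * (y₁ * y₂ - y₃ * y₄) + z₀ * ((y₁ * y₂ - y₃ * y₄) - (z₁ * z₂ - z₃ * z₄))|
        ≤ |(y₀ - z₀) * (y₁ * y₂ - y₃ * y₄)| + |z₀ * ((y₁ * y₂ - y₃ * y₄) - (z₁ * z₂ - z₃ * z₄))| :=
        abs_add_le _ _
    _ = |y₀ - z₀| * |y₁ * y₂ - y₃ * y₄| + |z₀| * |(y₁ * y₂ - y₃ * y₄) - (z₁ * z₂ - z₃ * z₄)| := by
        rw [abs_mul, abs_mul]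
    _ ≤ v * |z₀| * ((1 + u) ^ 2 * S) + |z₀| * ((2 * u + u ^ 2) * S) :=
        add_le_add (mul_le_mul h₀ hmabs (abs_nonneg _) (by positivity))
          (mul_le_mul_of_nonneg_left hm (abs_nonneg _))
    _ = (v * (1 + u) ^ 2 + 2 * u + u ^ 2) * (|z₀| * S) := by ring

/-- **The computed bound is not too small** (the `permanent` chain of `incircle`, five roundings
deep after the lifts, then `errbound = K ⊗ permanent`): with `S ≥ 0` the exact sums `|P| + |P'|`,
`L ≥ 0` the computed lifts, `A = fl(S)`, `α = fl(A·L)`, `W₁ = fl(α_a + α_b)`, `W = fl(W₁ + α_c)`,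
`E = fl(K·W)`, each with relative error `ε` w.r.t. the true operands,
`E ≥ (1 − ε)⁵·K·(L_a S_a + L_b S_b + L_c S_c)`. -/
theorem incirclePermanent_ge {u K Sa Sb Sc La Lb Lc Aa Ab Ac αa αb αc W₁ W E : ℚ}
    (hu0 : 0 ≤ u) (hu1 : u ≤ 1) (hK0 : 0 ≤ K) (hSa0 : 0 ≤ Sa) (hSb0 : 0 ≤ Sb) (hSc0 : 0 ≤ Sc)
    (hLa0 : 0 ≤ La) (hLb0 : 0 ≤ Lb) (hLc0 : 0 ≤ Lc)
    (hAa : |Sa - Aa| ≤ u * |Sa|) (hAb : |Sb - Ab| ≤ u * |Sb|) (hAc : |Sc - Ac| ≤ u * |Sc|)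
    (hαa : |Aa * La - αa| ≤ u * |Aa * La|) (hαb : |Ab * Lb - αb| ≤ u * |Ab * Lb|)
    (hαc : |Ac * Lc - αc| ≤ u * |Ac * Lc|)
    (hW₁ : |(αa + αb) - W₁| ≤ u * |αa + αb|) (hW : |(W₁ + αc) - W| ≤ u * |W₁ + αc|)
    (hE : |K * W - E| ≤ u * |K * W|) :
    (1 - u) ^ 5 * K * (La * Sa + Lb * Sb + Lc * Sc) ≤ E := by
  have h1u : 0 ≤ 1 - u := by linarith
  have hA : ∀ {S A : ℚ}, 0 ≤ S → |S - A| ≤ u * |S| → (1 - u) * S ≤ A := by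
    intro S A hS h
    have h' := (abs_sub_le_iff.mp h).1
    rw [abs_of_nonneg hS] at h'
    linarith
  have hAa1 := hA hSa0 hAa
  have hAb1 := hA hSb0 hAb
  have hAc1 := hA hSc0 hAc
  have hAa0 : 0 ≤ Aa := le_trans (mul_nonneg h1u hSa0) hAa1
  have hAb0 : 0 ≤ Ab := le_trans (mul_nonneg h1u hSb0) hAb1
  have hAc0 : 0 ≤ Ac := le_trans (mul_nonneg h1u hSc0) hAc1
  have hα : ∀ {S A L α : ℚ}, 0 ≤ S → 0 ≤ L → (1 - u) * S ≤ A → 0 ≤ A →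
      |A * L - α| ≤ u * |A * L| → (1 - u) ^ 2 * (L * S) ≤ α := by
    intro S A L α hS hL hA1 hA0 h
    have h' := (abs_sub_le_iff.mp h).1
    rw [abs_of_nonneg (mul_nonneg hA0 hL)] at h'
    calc (1 - u) ^ 2 * (L * S) = (1 - u) * L * ((1 - u) * S) := by ring
      _ ≤ (1 - u) * L * A := mul_le_mul_of_nonneg_left hA1 (mul_nonneg h1u hL)
      _ = (1 - u) * (A * L) := by ring
      _ ≤ α := by linarith
  have hαa1 := hα hSa0 hLa0 hAa1 hAa0 hαa
  have hαb1 := hα hSb0 hLb0 hAb1 hAb0 hαb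
  have hαc1 := hα hSc0 hLc0 hAc1 hAc0 hαc
  have h1u2 : 0 ≤ (1 - u) ^ 2 := pow_nonneg h1u 2
  have hαa0 : 0 ≤ αa := le_trans (mul_nonneg h1u2 (mul_nonneg hLa0 hSa0)) hαa1
  have hαb0 : 0 ≤ αb := le_trans (mul_nonneg h1u2 (mul_nonneg hLb0 hSb0)) hαb1
  have hαc0 : 0 ≤ αc := le_trans (mul_nonneg h1u2 (mul_nonneg hLc0 hSc0)) hαc1
  have hW₁1 : (1 - u) * (αa + αb) ≤ W₁ := by
    have h := (abs_sub_le_iff.mp hW₁).1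
    rw [abs_of_nonneg (add_nonneg hαa0 hαb0)] at h
    linarith
  have hW₁0 : 0 ≤ W₁ := le_trans (mul_nonneg h1u (add_nonneg hαa0 hαb0)) hW₁1
  have hW1 : (1 - u) * (W₁ + αc) ≤ W := by
    have h := (abs_sub_le_iff.mp hW).1
    rw [abs_of_nonneg (add_nonneg hW₁0 hαc0)] at h
    linarith
  have hW0 : 0 ≤ W := le_trans (mul_nonneg h1u (add_nonneg hW₁0 hαc0)) hW1
  have hW2 : (1 - u) ^ 4 * (La * Sa + Lb * Sb + Lc * Sc) ≤ W := by
    have h2 : (1 - u) ^ 4 * (Lc * Sc) ≤ (1 - u) * αc := by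
      calc (1 - u) ^ 4 * (Lc * Sc) = (1 - u) ^ 2 * ((1 - u) ^ 2 * (Lc * Sc)) := by ring
        _ ≤ (1 - u) ^ 2 * αc := mul_le_mul_of_nonneg_left hαc1 h1u2
        _ ≤ (1 - u) * αc := by
            have h : (1 - u) ^ 2 ≤ 1 - u := by nlinarith
            exact mul_le_mul_of_nonneg_right h hαc0
    have h3 : (1 - u) ^ 4 * (La * Sa + Lb * Sb) ≤ (1 - u) * W₁ := by
      calc (1 - u) ^ 4 * (La * Sa + Lb * Sb)
            = (1 - u) ^ 2 * ((1 - u) ^ 2 * (La * Sa) + (1 - u) ^ 2 * (Lb * Sb)) := by ring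
        _ ≤ (1 - u) ^ 2 * (αa + αb) := mul_le_mul_of_nonneg_left (add_le_add hαa1 hαb1) h1u2
        _ = (1 - u) * ((1 - u) * (αa + αb)) := by ring
        _ ≤ (1 - u) * W₁ := mul_le_mul_of_nonneg_left hW₁1 h1u
    have h4 : (1 - u) ^ 4 * (La * Sa + Lb * Sb + Lc * Sc)
        = (1 - u) ^ 4 * (La * Sa + Lb * Sb) + (1 - u) ^ 4 * (Lc * Sc) := by ring
    have h5 : (1 - u) * W₁ + (1 - u) * αc = (1 - u) * (W₁ + αc) := by ring
    linarith
  have hE1 : (1 - u) * (K * W) ≤ E := by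
    have h := (abs_sub_le_iff.mp hE).1
    rw [abs_of_nonneg (mul_nonneg hK0 hW0)] at h
    linarith
  calc (1 - u) ^ 5 * K * (La * Sa + Lb * Sb + Lc * Sc)
        = (1 - u) * (K * ((1 - u) ^ 4 * (La * Sa + Lb * Sb + Lc * Sc))) := by ring
    _ ≤ (1 - u) * (K * W) := mul_le_mul_of_nonneg_left (mul_le_mul_of_nonneg_left hW2 hK0) h1u
    _ ≤ E := hE1

/-! ## The stage-B test -/

/-- **The sign test of INCIRCLE's stage B is sound, as an inequality between rationals, for any
constant `K` and estimate error `δ` satisfying the margin** `(1 + δ)(4ε + 18ε² + 34ε³ + 35ε⁴ +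
21ε⁵ + 7ε⁶ + ε⁷) < (1 − ε)⁵K` (`0 < ε ≤ 1/2`, `0 ≤ δ < 1`).  Data: true differences `t = x ± ε|x|`;
computed products `x·x' = P ± ε|P|`, squares `x² = S ± εS`, lifts `S + S' = L ± εL` (as in stage
A); the permanent chain of `incirclePermanent_ge`; `|det − B| ≤ δ|B|` for `B :=` the incircle
determinant of the computed differences; the passed test `E ≤ |det|`.  Then `B` has the sign of the
true determinant `T` (strictly, both ways), and so has `det`. -/
theorem incircle_stageB_sign_of_bounds
    {u K δ ta₁ ta₂ tb₁ tb₂ tc₁ tc₂ xa₁ xa₂ xb₁ xb₂ xc₁ xc₂ P₁ P₂ P₃ P₄ P₅ P₆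
      Sa₁ Sa₂ Sb₁ Sb₂ Sc₁ Sc₂ La Lb Lc det Aa Ab Ac αa αb αc W₁ W E : ℚ}
    (hu0 : 0 < u) (hu1 : u ≤ 1 / 2) (hδ : 0 ≤ δ) (hδ1 : δ < 1)
    (hmargin : (1 + δ) * (4 * u + 18 * u ^ 2 + 34 * u ^ 3 + 35 * u ^ 4 + 21 * u ^ 5
      + 7 * u ^ 6 + u ^ 7) < (1 - u) ^ 5 * K)
    (ha₁ : |ta₁ - xa₁| ≤ u * |xa₁|) (ha₂ : |ta₂ - xa₂| ≤ u * |xa₂|)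
    (hb₁ : |tb₁ - xb₁| ≤ u * |xb₁|) (hb₂ : |tb₂ - xb₂| ≤ u * |xb₂|)
    (hc₁ : |tc₁ - xc₁| ≤ u * |xc₁|) (hc₂ : |tc₂ - xc₂| ≤ u * |xc₂|)
    (hP₁ : |xb₁ * xc₂ - P₁| ≤ u * |P₁|) (hP₂ : |xc₁ * xb₂ - P₂| ≤ u * |P₂|)
    (hP₃ : |xc₁ * xa₂ - P₃| ≤ u * |P₃|) (hP₄ : |xa₁ * xc₂ - P₄| ≤ u * |P₄|)
    (hP₅ : |xa₁ * xb₂ - P₅| ≤ u * |P₅|) (hP₆ : |xb₁ * xa₂ - P₆| ≤ u * |P₆|)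
    (hSa₁ : |xa₁ * xa₁ - Sa₁| ≤ u * |Sa₁|) (hSa₂ : |xa₂ * xa₂ - Sa₂| ≤ u * |Sa₂|)
    (hSb₁ : |xb₁ * xb₁ - Sb₁| ≤ u * |Sb₁|) (hSb₂ : |xb₂ * xb₂ - Sb₂| ≤ u * |Sb₂|)
    (hSc₁ : |xc₁ * xc₁ - Sc₁| ≤ u * |Sc₁|) (hSc₂ : |xc₂ * xc₂ - Sc₂| ≤ u * |Sc₂|)
    (hSa₁0 : 0 ≤ Sa₁) (hSa₂0 : 0 ≤ Sa₂) (hSb₁0 : 0 ≤ Sb₁) (hSb₂0 : 0 ≤ Sb₂)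
    (hSc₁0 : 0 ≤ Sc₁) (hSc₂0 : 0 ≤ Sc₂)
    (hLa : |(Sa₁ + Sa₂) - La| ≤ u * |La|) (hLb : |(Sb₁ + Sb₂) - Lb| ≤ u * |Lb|)
    (hLc : |(Sc₁ + Sc₂) - Lc| ≤ u * |Lc|) (hLa0 : 0 ≤ La) (hLb0 : 0 ≤ Lb) (hLc0 : 0 ≤ Lc)
    (hAa : |(|P₁| + |P₂|) - Aa| ≤ u * |(|P₁| + |P₂|)|)
    (hAb : |(|P₃| + |P₄|) - Ab| ≤ u * |(|P₃| + |P₄|)|)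
    (hAc : |(|P₅| + |P₆|) - Ac| ≤ u * |(|P₅| + |P₆|)|)
    (hαa : |Aa * La - αa| ≤ u * |Aa * La|) (hαb : |Ab * Lb - αb| ≤ u * |Ab * Lb|)
    (hαc : |Ac * Lc - αc| ≤ u * |Ac * Lc|)
    (hW₁ : |(αa + αb) - W₁| ≤ u * |αa + αb|) (hW : |(W₁ + αc) - W| ≤ u * |W₁ + αc|)
    (hE : |K * W - E| ≤ u * |K * W|)
    (hdet : |det - ((xa₁ * xa₁ + xa₂ * xa₂) * (xb₁ * xc₂ - xc₁ * xb₂)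
        + (xb₁ * xb₁ + xb₂ * xb₂) * (xc₁ * xa₂ - xa₁ * xc₂)
        + (xc₁ * xc₁ + xc₂ * xc₂) * (xa₁ * xb₂ - xb₁ * xa₂))|
      ≤ δ * |(xa₁ * xa₁ + xa₂ * xa₂) * (xb₁ * xc₂ - xc₁ * xb₂)
        + (xb₁ * xb₁ + xb₂ * xb₂) * (xc₁ * xa₂ - xa₁ * xc₂)
        + (xc₁ * xc₁ + xc₂ * xc₂) * (xa₁ * xb₂ - xb₁ * xa₂)|)
    (htest : E ≤ |det|) :
    ((0 < (xa₁ * xa₁ + xa₂ * xa₂) * (xb₁ * xc₂ - xc₁ * xb₂)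
          + (xb₁ * xb₁ + xb₂ * xb₂) * (xc₁ * xa₂ - xa₁ * xc₂)
          + (xc₁ * xc₁ + xc₂ * xc₂) * (xa₁ * xb₂ - xb₁ * xa₂) ↔
        0 < (ta₁ * ta₁ + ta₂ * ta₂) * (tb₁ * tc₂ - tc₁ * tb₂)
          + (tb₁ * tb₁ + tb₂ * tb₂) * (tc₁ * ta₂ - ta₁ * tc₂)
          + (tc₁ * tc₁ + tc₂ * tc₂) * (ta₁ * tb₂ - tb₁ * ta₂)) ∧
      ((xa₁ * xa₁ + xa₂ * xa₂) * (xb₁ * xc₂ - xc₁ * xb₂)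
          + (xb₁ * xb₁ + xb₂ * xb₂) * (xc₁ * xa₂ - xa₁ * xc₂)
          + (xc₁ * xc₁ + xc₂ * xc₂) * (xa₁ * xb₂ - xb₁ * xa₂) < 0 ↔
        (ta₁ * ta₁ + ta₂ * ta₂) * (tb₁ * tc₂ - tc₁ * tb₂)
          + (tb₁ * tb₁ + tb₂ * tb₂) * (tc₁ * ta₂ - ta₁ * tc₂)
          + (tc₁ * tc₁ + tc₂ * tc₂) * (ta₁ * tb₂ - tb₁ * ta₂) < 0)) ∧
      ((0 < (xa₁ * xa₁ + xa₂ * xa₂) * (xb₁ * xc₂ - xc₁ * xb₂)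
          + (xb₁ * xb₁ + xb₂ * xb₂) * (xc₁ * xa₂ - xa₁ * xc₂)
          + (xc₁ * xc₁ + xc₂ * xc₂) * (xa₁ * xb₂ - xb₁ * xa₂) ↔ 0 < det) ∧
        ((xa₁ * xa₁ + xa₂ * xa₂) * (xb₁ * xc₂ - xc₁ * xb₂)
          + (xb₁ * xb₁ + xb₂ * xb₂) * (xc₁ * xa₂ - xa₁ * xc₂)
          + (xc₁ * xc₁ + xc₂ * xc₂) * (xa₁ * xb₂ - xb₁ * xa₂) < 0 ↔ det < 0)) := by
  set B := (xa₁ * xa₁ + xa₂ * xa₂) * (xb₁ * xc₂ - xc₁ * xb₂)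
    + (xb₁ * xb₁ + xb₂ * xb₂) * (xc₁ * xa₂ - xa₁ * xc₂)
    + (xc₁ * xc₁ + xc₂ * xc₂) * (xa₁ * xb₂ - xb₁ * xa₂) with hB
  set T := (ta₁ * ta₁ + ta₂ * ta₂) * (tb₁ * tc₂ - tc₁ * tb₂)
    + (tb₁ * tb₁ + tb₂ * tb₂) * (tc₁ * ta₂ - ta₁ * tc₂)
    + (tc₁ * tc₁ + tc₂ * tc₂) * (ta₁ * tb₂ - tb₁ * ta₂) with hT
  set v := 2 * u + u ^ 2 with hv
  set g := v * (1 + u) ^ 2 + 2 * u + u ^ 2 with hg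
  set Sa := |P₁| + |P₂| with hSa
  set Sb := |P₃| + |P₄| with hSb
  set Sc := |P₅| + |P₆| with hSc
  have hSa0 : 0 ≤ Sa := by rw [hSa]; positivity
  have hSb0 : 0 ≤ Sb := by rw [hSb]; positivity
  have hSc0 : 0 ≤ Sc := by rw [hSc]; positivity
  have h1u : 0 < 1 - u := by linarith
  have hv0 : 0 ≤ v := by rw [hv]; positivity
  have hg0 : 0 ≤ g := by rw [hg]; positivity
  -- `K ≥ 0` from the margin
  have hK0 : 0 ≤ K := by
    have h2 : 0 ≤ (1 + δ) * (4 * u + 18 * u ^ 2 + 34 * u ^ 3 + 35 * u ^ 4 + 21 * u ^ 5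
        + 7 * u ^ 6 + u ^ 7) := by positivity
    exact (pos_of_mul_pos_right (h2.trans_lt hmargin) (pow_nonneg h1u.le 5)).le
  -- exact products vs computed products: `|x x'| ≤ (1 + ε)|P|`
  have hxP : ∀ {x y P : ℚ}, |x * y - P| ≤ u * |P| → |x * y| ≤ (1 + u) * |P| :=
    fun {x y P} h => by linarith [abs_sub_abs_le_abs_sub (x * y) P]
  -- the exact lifts of the computed differences: nonnegative, `≤ (1 + ε)²L`
  have hXa0 : 0 ≤ xa₁ * xa₁ + xa₂ * xa₂ := add_nonneg (mul_self_nonneg _) (mul_self_nonneg _)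
  have hXb0 : 0 ≤ xb₁ * xb₁ + xb₂ * xb₂ := add_nonneg (mul_self_nonneg _) (mul_self_nonneg _)
  have hXc0 : 0 ≤ xc₁ * xc₁ + xc₂ * xc₂ := add_nonneg (mul_self_nonneg _) (mul_self_nonneg _)
  have hXa := sumSq_le_of_rel hu0.le hSa₁ hSa₂ hSa₁0 hSa₂0 hLa hLa0
  have hXb := sumSq_le_of_rel hu0.le hSb₁ hSb₂ hSb₁0 hSb₂0 hLb hLb0
  have hXc := sumSq_le_of_rel hu0.le hSc₁ hSc₂ hSc₁0 hSc₂0 hLc hLc0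
  -- the true lifts against the exact lifts of the computed differences
  have la : |(ta₁ * ta₁ + ta₂ * ta₂) - (xa₁ * xa₁ + xa₂ * xa₂)| ≤ v * |xa₁ * xa₁ + xa₂ * xa₂| := by
    rw [abs_of_nonneg hXa0]; exact sumSq_sub_sumSq_le_of_rel hu0.le ha₁ ha₂
  have lb : |(tb₁ * tb₁ + tb₂ * tb₂) - (xb₁ * xb₁ + xb₂ * xb₂)| ≤ v * |xb₁ * xb₁ + xb₂ * xb₂| := by
    rw [abs_of_nonneg hXb0]; exact sumSq_sub_sumSq_le_of_rel hu0.le hb₁ hb₂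
  have lc : |(tc₁ * tc₁ + tc₂ * tc₂) - (xc₁ * xc₁ + xc₂ * xc₂)| ≤ v * |xc₁ * xc₁ + xc₂ * xc₂| := by
    rw [abs_of_nonneg hXc0]; exact sumSq_sub_sumSq_le_of_rel hu0.le hc₁ hc₂
  -- `|T − B| ≤ g·Σ lift_x·(|x x'| + |x'' x'''|) ≤ g(1 + ε)³·Π`
  have ea := liftedCofactorB_sub_le_of_rel hu0.le hv0 la hb₁ hc₂ hc₁ hb₂
  have eb := liftedCofactorB_sub_le_of_rel hu0.le hv0 lb hc₁ ha₂ ha₁ hc₂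
  have ec := liftedCofactorB_sub_le_of_rel hu0.le hv0 lc ha₁ hb₂ hb₁ ha₂
  -- per term: `lift_x·(|x x'| + |x″ x‴|) ≤ (1 + ε)³·L·(|P| + |P'|)`
  have hp3 : ∀ {X L x₁ x₂ x₃ x₄ Q₁ Q₂ : ℚ}, |X| ≤ (1 + u) ^ 2 * L → 0 ≤ L →
      |x₁ * x₂ - Q₁| ≤ u * |Q₁| → |x₃ * x₄ - Q₂| ≤ u * |Q₂| →
      g * (|X| * (|x₁ * x₂| + |x₃ * x₄|)) ≤ g * ((1 + u) ^ 3 * (L * (|Q₁| + |Q₂|))) := by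
    intro X L x₁ x₂ x₃ x₄ Q₁ Q₂ hX hL h₁ h₂
    refine mul_le_mul_of_nonneg_left ?_ hg0
    calc |X| * (|x₁ * x₂| + |x₃ * x₄|) ≤ ((1 + u) ^ 2 * L) * ((1 + u) * |Q₁| + (1 + u) * |Q₂|) :=
          mul_le_mul hX (add_le_add (hxP h₁) (hxP h₂)) (by positivity) (by positivity)
      _ = (1 + u) ^ 3 * (L * (|Q₁| + |Q₂|)) := by ring
  have qa := ea.trans (hp3 ((abs_of_nonneg hXa0).trans_le hXa) hLa0 hP₁ hP₂)
  have qb := eb.trans (hp3 ((abs_of_nonneg hXb0).trans_le hXb) hLb0 hP₃ hP₄)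
  have qc := ec.trans (hp3 ((abs_of_nonneg hXc0).trans_le hXc) hLc0 hP₅ hP₆)
  have hTB : |T - B| ≤ g * (1 + u) ^ 3 * (La * Sa + Lb * Sb + Lc * Sc) := by
    have hdec : T - B
        = ((ta₁ * ta₁ + ta₂ * ta₂) * (tb₁ * tc₂ - tc₁ * tb₂)
            - (xa₁ * xa₁ + xa₂ * xa₂) * (xb₁ * xc₂ - xc₁ * xb₂))
        + ((tb₁ * tb₁ + tb₂ * tb₂) * (tc₁ * ta₂ - ta₁ * tc₂)
            - (xb₁ * xb₁ + xb₂ * xb₂) * (xc₁ * xa₂ - xa₁ * xc₂))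
        + ((tc₁ * tc₁ + tc₂ * tc₂) * (ta₁ * tb₂ - tb₁ * ta₂)
            - (xc₁ * xc₁ + xc₂ * xc₂) * (xa₁ * xb₂ - xb₁ * xa₂)) := by
      rw [hT, hB]; ring
    rw [hdec]
    refine (abs_add_three _ _ _).trans ?_
    have hsum : g * ((1 + u) ^ 3 * (La * Sa)) + g * ((1 + u) ^ 3 * (Lb * Sb))
        + g * ((1 + u) ^ 3 * (Lc * Sc)) = g * (1 + u) ^ 3 * (La * Sa + Lb * Sb + Lc * Sc) := by
      ring
    rw [hSa, hSb, hSc] at hsum ⊢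
    linarith
  -- the computed bound
  have hE2 : (1 - u) ^ 5 * K * (La * Sa + Lb * Sb + Lc * Sc) ≤ E :=
    incirclePermanent_ge hu0.le (by linarith) hK0 hSa0 hSb0 hSc0 hLa0 hLb0 hLc0 hAa hAb hAc
      hαa hαb hαc hW₁ hW hE
  have hdetB : |det| ≤ (1 + δ) * |B| := by linarith [abs_sub_abs_le_abs_sub det B]
  -- the margin: `g(1+ε)³Π(1+δ) < (1−ε)⁵KΠ ≤ E ≤ |det| ≤ (1+δ)|B|`, unless `Π = 0`
  have hPi0 : 0 ≤ La * Sa + Lb * Sb + Lc * Sc := by positivity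
  have hgid : g * (1 + u) ^ 3
      = 4 * u + 18 * u ^ 2 + 34 * u ^ 3 + 35 * u ^ 4 + 21 * u ^ 5 + 7 * u ^ 6 + u ^ 7 := by
    rw [hg, hv]; ring
  have hBT : (0 < B ↔ 0 < T) ∧ (B < 0 ↔ T < 0) := by
    rcases hPi0.lt_or_eq with hPi | hPi
    · -- `Π > 0`: the margin gives `|T − B| < |B|`
      have h1 : (1 + δ) * (g * (1 + u) ^ 3 * (La * Sa + Lb * Sb + Lc * Sc))
          < (1 - u) ^ 5 * K * (La * Sa + Lb * Sb + Lc * Sc) := by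
        have := mul_lt_mul_of_pos_right hmargin hPi
        calc (1 + δ) * (g * (1 + u) ^ 3 * (La * Sa + Lb * Sb + Lc * Sc))
            = (1 + δ) * (4 * u + 18 * u ^ 2 + 34 * u ^ 3 + 35 * u ^ 4 + 21 * u ^ 5
                + 7 * u ^ 6 + u ^ 7) * (La * Sa + Lb * Sb + Lc * Sc) := by rw [← hgid]; ring
          _ < (1 - u) ^ 5 * K * (La * Sa + Lb * Sb + Lc * Sc) := this
      have h2 : (1 + δ) * |T - B| ≤
          (1 + δ) * (g * (1 + u) ^ 3 * (La * Sa + Lb * Sb + Lc * Sc)) :=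
        mul_le_mul_of_nonneg_left hTB (by linarith)
      have h3 : (1 + δ) * |T - B| < (1 + δ) * |B| := by linarith
      exact sign_iff_of_abs_sub_lt (lt_of_mul_lt_mul_left h3 (by linarith))
    · -- `Π = 0`: then `T = B`
      have hTB0 : |T - B| ≤ 0 := by
        have h := hTB
        rw [← hPi, mul_zero] at h
        exact h
      have hTBeq : T = B := by
        have h0 : |T - B| = 0 := le_antisymm hTB0 (abs_nonneg _)
        linarith [abs_eq_zero.mp h0]
      rw [hTBeq]
      exact ⟨Iff.rfl, Iff.rfl⟩
  have hBdet : (0 < B ↔ 0 < det) ∧ (B < 0 ↔ det < 0) := by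
    by_cases hB0 : B = 0
    · have hd : det = 0 := by
        have h := hdet
        rw [hB0, sub_zero, abs_zero, mul_zero] at h
        exact abs_eq_zero.mp (le_antisymm h (abs_nonneg _))
      rw [hB0, hd]
      exact ⟨Iff.rfl, Iff.rfl⟩
    · have hBpos : 0 < |B| := abs_pos.mpr hB0
      have h1 : δ * |B| < |B| := by
        calc δ * |B| < 1 * |B| := mul_lt_mul_of_pos_right hδ1 hBpos
          _ = |B| := one_mul _
      exact sign_iff_of_abs_sub_lt (lt_of_le_of_lt hdet h1)
  exact ⟨hBT, hBdet⟩

end Summit.Ventures.CertifiedArithmetic.Expansions
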